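import Summits.AnomalousDissipation.AnomalousDissipation.Theorems.KolmogorovFloor.Negative.AxisBeatOffset

/-!
# The axis-carrier beat with SLOPE-WEIGHTED gain (negative side of `KolmogorovFloor`, stmt-14030)

cdisprove seat `refuter-cdisprove-stmt-AnomalousDissipation-14030-0` (2026-08-16). Same carriers and
polarisations as `Negative/AxisBeatOffset.lean :: axis_beat_data_offset` (`p = m eᵢ − q`, `p + q = m eᵢ`,
`m = 3N + 1 + 2K₀`), but the gain keeps the factor `|q|` that `axis_gain_bound` discarded:
`gain ≥ (9/10) α² · |q| ‖ĝ‖` (`axis_gain_bound_sqrt`, `axis_beat_data_slope`). This is the beat that harvests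
the SLOPE `max_k |k|‖Ŵ(k)‖` of a band-limited multiplier — the quantity against which the drift `ν(a, ΔW)` and
the steady-Euler defect of a cheap base state are measured (`Negative/CheapBase*.lean`: quiet Euler points,
dressed rays).
-/

noncomputable section

open MeasureTheory UnitAddTorus Matrix
open scoped InnerProductSpace ENNReal ComplexConjugate

namespace Summit.AnomalousDissipation.AnomalousDissipation.Theorems.KolmogorovFloor.Negative

open Literature.Analysis.FunctionSpaces Literature.Analysis.FluidPDE
open Summit.AnomalousDissipation.AnomalousDissipation.Theorems.TaylorCertificatePair.Negative

/-- The slope-weighted gain of the axis beat: with `r = α D/‖v‖`, `‖v‖² = |p|² D`, `D = m² |c|²`, `|p|² ≤ 4m²`,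
`|c|² ≥ 1`, `‖ζ‖² |c|² = T`, `|q|² ‖ĝ‖² ≤ 3T`: `(9/10) α² (|q| ‖ĝ‖) ≤ π r α ‖ζ‖` (`π² > 9.72`). -/
theorem axis_gain_bound_sqrt {r ζn α gn cc pp D m T fq nv : ℝ} (hr : r = α * D / nv) (hnv2 : nv ^ 2 = pp * D)
    (hnv : 0 < nv) (hD : D = m ^ 2 * cc) (hcc : 1 ≤ cc) (hpp4 : pp ≤ 4 * m ^ 2) (hpp0 : 0 < pp)
    (hζ2 : ζn ^ 2 * cc = T) (hT : fq * gn ^ 2 ≤ 3 * T) (hfq : 0 ≤ fq) (hα : 0 ≤ α) (hgn : 0 ≤ gn)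
    (hζn : 0 ≤ ζn) (hm : 0 < m) : 9 / 10 * α ^ 2 * (Real.sqrt fq * gn) ≤ Real.pi * r * α * ζn := by
  have hcc0 : 0 < cc := by linarith
  have hD0 : 0 < D := by rw [hD]; positivity
  have hr2 : r ^ 2 * pp = α ^ 2 * D := by
    rw [hr, div_pow, mul_pow]
    have : nv ^ 2 ≠ 0 := by positivity
    field_simp
    rw [hnv2]
    ring
  have hr0 : 0 ≤ r := by rw [hr]; positivity
  have hr2' : α ^ 2 * cc ≤ 4 * r ^ 2 := by
    have h1 : α ^ 2 * (m ^ 2 * cc) ≤ r ^ 2 * (4 * m ^ 2) := by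
      rw [← hD, ← hr2]
      exact mul_le_mul_of_nonneg_left hpp4 (sq_nonneg r)
    have hm2 : 0 < m ^ 2 := by positivity
    nlinarith
  -- `fq gn² ≤ 3 ζn² cc`
  have hζ2' : fq * gn ^ 2 ≤ 3 * (ζn ^ 2 * cc) := by rw [hζ2]; exact hT
  -- `(α² cc)(fq gn²) ≤ (4r²)(3ζn²cc)`, cancel `cc`
  have hprod : α ^ 2 * (fq * gn ^ 2) ≤ 12 * (r ^ 2 * ζn ^ 2) := by
    have h := mul_le_mul hr2' hζ2' (by positivity) (by positivity)
    have e : 4 * r ^ 2 * (3 * (ζn ^ 2 * cc)) = (12 * (r ^ 2 * ζn ^ 2)) * cc := by ring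
    have e' : α ^ 2 * cc * (fq * gn ^ 2) = (α ^ 2 * (fq * gn ^ 2)) * cc := by ring
    rw [e, e'] at h
    exact le_of_mul_le_mul_right h hcc0
  have hsq : (9 / 10 * α ^ 2 * (Real.sqrt fq * gn)) ^ 2 ≤ (Real.pi * r * α * ζn) ^ 2 := by
    have hp := pi_sq_gt
    have e1 : (9 / 10 * α ^ 2 * (Real.sqrt fq * gn)) ^ 2 = 81 / 100 * α ^ 2 * (α ^ 2 * (fq * gn ^ 2)) := by
      rw [show (9 / 10 * α ^ 2 * (Real.sqrt fq * gn)) ^ 2 =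
          81 / 100 * α ^ 2 * (α ^ 2 * ((Real.sqrt fq) ^ 2 * gn ^ 2)) by ring, Real.sq_sqrt hfq]
    have e2 : (Real.pi * r * α * ζn) ^ 2 = Real.pi ^ 2 * α ^ 2 * (r ^ 2 * ζn ^ 2) := by ring
    rw [e1, e2]
    have hα2 : 0 ≤ α ^ 2 := sq_nonneg α
    have hrz : 0 ≤ r ^ 2 * ζn ^ 2 := by positivity
    have h1 := mul_le_mul_of_nonneg_left hprod hα2
    have h2 := mul_nonneg hα2 hrz
    nlinarith only [h1, h2, hp]
  exact (pow_le_pow_iff_left₀ (by positivity) (by positivity) two_ne_zero).1 hsq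

/-- **Axis-carrier beat with slope-weighted gain.** As `axis_beat_data_offset` (carriers `p`, `p + q` outside the
ball `|·| ≤ N`, of size `≤ 4N + 1 + 2K₀`, separated by `> N` from every `k` with `|kⱼ| ≤ K₀`; transversal
polarisations of norm `≤ α`; the beat `π·Im(conj(q·z_A)⟪ĝ, z_B⟫) ≤ −gain`), with `gain ≥ (9/10) α² |q| ‖ĝ‖`. -/
theorem axis_beat_data_slope {q : Fin 3 → ℤ} (hq0 : q ≠ 0) {N : ℕ} (K₀ : ℕ) (hqN : Torus.freqNormSq q ≤ (N : ℝ) ^ 2)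
    (g : (EuclideanSpace ℂ (Fin 3))) (hg0 : g ≠ 0) (hgq : ((fun j => ((q) j : ℂ)) ⬝ᵥ (WithLp.ofLp (g))) = 0)
    {α : ℝ} (hα : 0 ≤ α) :
    ∃ (p : Fin 3 → ℤ) (zA zB : (EuclideanSpace ℂ (Fin 3))) (gain : ℝ),
      (N : ℝ) ^ 2 < Torus.freqNormSq p ∧ (N : ℝ) ^ 2 < Torus.freqNormSq (p + q) ∧
      (N : ℝ) ^ 2 < Torus.freqNormSq (p + (p + q)) ∧
      Torus.freqNormSq p ≤ ((4 * N + 1 + 2 * K₀ : ℕ) : ℝ) ^ 2 ∧ Torus.freqNormSq (p + q) ≤ ((4 * N + 1 + 2 * K₀ : ℕ) : ℝ) ^ 2 ∧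
      (∀ k : Fin 3 → ℤ, (∀ j, ((k j : ℝ)) ^ 2 ≤ (K₀ : ℝ) ^ 2) →
        (N : ℝ) ^ 2 < Torus.freqNormSq (p + k) ∧ (N : ℝ) ^ 2 < Torus.freqNormSq (p - k) ∧
        (N : ℝ) ^ 2 < Torus.freqNormSq (p + q + k) ∧ (N : ℝ) ^ 2 < Torus.freqNormSq (p + q - k)) ∧
      ((fun j => ((p) j : ℂ)) ⬝ᵥ (WithLp.ofLp (zA))) = 0 ∧ ((fun j => (((p + q)) j : ℂ)) ⬝ᵥ (WithLp.ofLp (zB))) = 0 ∧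
      ((fun j => ((q) j : ℂ)) ⬝ᵥ (WithLp.ofLp (zB))) = 0 ∧ ‖zA‖ ≤ α ∧ ‖zB‖ ≤ α ∧
      Real.pi * (conj (((fun j => ((q) j : ℂ)) ⬝ᵥ (WithLp.ofLp (zA)))) * ⟪g, zB⟫_ℂ).im ≤ -gain ∧
      9 / 10 * α ^ 2 * (Real.sqrt (Torus.freqNormSq q) * ‖g‖) ≤ gain := by
  -- axis and its cross vector
  obtain ⟨i, hc0, hT⟩ := axis_selection g hg0 hgq hq0
  set c : Fin 3 → ℤ := (![![0, -(q 2), q 1], ![q 2, 0, -(q 0)], ![-(q 1), q 0, 0]] : Fin 3 → (Fin 3 → ℤ)) i with hcdef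
  have hcq : c ⬝ᵥ q = 0 := axisCross_dot q i
  set a : Fin 3 → ℝ := fun j => ((c j : ℝ)) with hadef
  have hcc1 : 1 ≤ Torus.freqNormSq c := Torus.one_le_freqNormSq_of_ne_zero hc0
  have haa : a ⬝ᵥ a = Torus.freqNormSq c := by rw [freqNormSq_eq_castR_dot]
  have ha2 : 0 < a ⬝ᵥ a := by rw [haa]; linarith
  obtain ⟨hB1, hBw⟩ := unit_along a ha2
  set B : (EuclideanSpace ℝ (Fin 3)) := (Real.sqrt (a ⬝ᵥ a))⁻¹ • (WithLp.toLp 2 a : (EuclideanSpace ℝ (Fin 3))) with hBdef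
  have hs0 : 0 < Real.sqrt (a ⬝ᵥ a) := Real.sqrt_pos.2 ha2
  -- the captured coefficient `ζ = ⟪ĝ, B⟫`
  set ζ : ℂ := ⟪g, EuclideanSpace.complexify B⟫_ℂ with hζdef
  have hζ : ζ = (((Real.sqrt (a ⬝ᵥ a))⁻¹ : ℝ) : ℂ) * ⟪g, EuclideanSpace.complexify (WithLp.toLp 2 a)⟫_ℂ := by
    rw [hζdef, hBdef, LinearIsometry.map_smul, ← Complex.coe_smul, inner_smul_right]
  have hζn : ‖ζ‖ ^ 2 * Torus.freqNormSq c = ‖⟪g, EuclideanSpace.complexify (WithLp.toLp 2 a)⟫_ℂ‖ ^ 2 := by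
    rw [hζ, norm_mul, Complex.norm_real, Real.norm_of_nonneg (inv_nonneg.2 hs0.le), mul_pow, inv_pow,
      Real.sq_sqrt ha2.le, haa]
    have : Torus.freqNormSq c ≠ 0 := by linarith
    field_simp
  have hζ0 : ζ ≠ 0 := by
    intro h
    rw [h, norm_zero] at hζn
    have hq1 : 1 ≤ Torus.freqNormSq q := Torus.one_le_freqNormSq_of_ne_zero hq0
    have hgp : 0 < ‖g‖ ^ 2 := by positivity
    have : ‖⟪g, EuclideanSpace.complexify (WithLp.toLp 2 a)⟫_ℂ‖ ^ 2 = 0 := by rw [← hζn]; ring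
    rw [hadef] at this
    rw [this] at hT
    nlinarith
  -- carriers
  set m : ℤ := ((3 * N + 1 + 2 * K₀ : ℕ) : ℤ) with hmdef
  obtain ⟨hNp, hNpq, hN5, hLp, hLpq, hsep⟩ := axis_carriers_offset N K₀ hqN i
  set p : Fin 3 → ℤ := Pi.single i m - q with hpdef
  have hpq : p + q = Pi.single i m := by rw [hpdef, sub_add_cancel]
  -- polarisation `z_B`
  set zB : (EuclideanSpace ℂ (Fin 3)) := (((-Complex.I * conj ((ζ)) * ((‖(ζ)‖⁻¹ : ℝ) : ℂ)) * ((α) : ℂ)) • EuclideanSpace.complexify (B)) with hzBdef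
  have hzBn : ‖zB‖ = α := norm_polB α hα hζ0 hB1
  have hdB : ((fun j => (((p + q)) j : ℂ)) ⬝ᵥ (WithLp.ofLp (zB))) = 0 := by
    rw [hzBdef, dotc_polB, hpq, hBw, single_dot_axisCross]
    simp
  have hBq : ((fun j => ((q) j : ℂ)) ⬝ᵥ (WithLp.ofLp (zB))) = 0 := by
    rw [hzBdef, dotc_polB, hBw]
    have : (fun j => ((q) j : ℝ)) ⬝ᵥ a = 0 := by
      rw [hadef, castR_dot, dotProduct_comm, hcq]; simp
    rw [this]; simp
  -- polarisation `z_A`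
  set v : Fin 3 → ℤ := (p ⬝ᵥ p) • q - (q ⬝ᵥ p) • p with hvdef
  set D : ℤ := (p ⬝ᵥ p) * (q ⬝ᵥ q) - (q ⬝ᵥ p) ^ 2 with hDdef
  have hDv : q ⬝ᵥ v = D := by rw [hvdef, hDdef]; exact q_dot_pol p q
  have hpv : p ⬝ᵥ v = 0 := by rw [hvdef, dotProduct_comm]; exact pol_dot_p p q
  have hvv : v ⬝ᵥ v = (p ⬝ᵥ p) * D := by rw [hvdef, hDdef]; exact pol_dot_pol p q
  have hDm : D = m ^ 2 * (c ⬝ᵥ c) := by rw [hDdef, hpdef, hcdef]; exact lagrange_axis i m q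
  have hcc : ((c ⬝ᵥ c : ℤ) : ℝ) = Torus.freqNormSq c := by rw [freqNormSq_eq_castR_dot, castR_dot]
  have hpp : ((p ⬝ᵥ p : ℤ) : ℝ) = Torus.freqNormSq p := by rw [freqNormSq_eq_castR_dot, castR_dot]
  have hp1 : 1 ≤ Torus.freqNormSq p := by
    have hp0 : p ≠ 0 := ne_zero_of_freqNormSq_pos (sq_nonneg _) hNp
    exact Torus.one_le_freqNormSq_of_ne_zero hp0
  have hmR : (m : ℝ) = 3 * N + 1 + 2 * K₀ := by rw [hmdef]; push_cast; ring
  have hm1 : (1 : ℝ) ≤ (m : ℝ) := by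
    rw [hmR]; linarith [(Nat.cast_nonneg N : (0:ℝ) ≤ N), (Nat.cast_nonneg K₀ : (0:ℝ) ≤ K₀)]
  have hDpos : 0 < (D : ℝ) := by
    rw [hDm]; push_cast; rw [hcc]
    have : (1 : ℝ) ≤ (m : ℝ) ^ 2 := one_le_pow₀ hm1
    nlinarith
  set vL : (EuclideanSpace ℝ (Fin 3)) := WithLp.toLp 2 (fun j => ((v j : ℝ))) with hvLdef
  have hvL2 : ‖vL‖ ^ 2 = Torus.freqNormSq p * D := by
    rw [hvLdef, norm_sq_toLp, castR_dot, hvv]; push_cast; rw [hpp]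
  have hvLpos : 0 < ‖vL‖ := by
    have h2 : 0 < ‖vL‖ ^ 2 := by rw [hvL2]; positivity
    rcases (norm_nonneg vL).lt_or_eq with h | h
    · exact h
    · rw [← h] at h2; simp at h2
  set zA : (EuclideanSpace ℂ (Fin 3)) := (((α / ‖vL‖ : ℝ)) : ℂ) • EuclideanSpace.complexify vL with hzAdef
  have hzAn : ‖zA‖ = α := by
    rw [hzAdef, norm_smul, Complex.norm_real, Real.norm_of_nonneg (div_nonneg hα hvLpos.le),
      EuclideanSpace.norm_complexify, div_mul_cancel₀ _ hvLpos.ne']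
  have hdotA : ∀ κ : Fin 3 → ℤ, ((fun j => ((κ) j : ℂ)) ⬝ᵥ (WithLp.ofLp (zA))) =
      (((α / ‖vL‖ : ℝ)) : ℂ) * ((κ ⬝ᵥ v : ℤ) : ℂ) := by
    intro κ
    rw [hzAdef, dotc_smul, hvLdef, dotc_complexify_castR]
  have hdA : ((fun j => ((p) j : ℂ)) ⬝ᵥ (WithLp.ofLp (zA))) = 0 := by
    rw [hdotA, hpv]; simp
  have hqzA : ((fun j => ((q) j : ℂ)) ⬝ᵥ (WithLp.ofLp (zA))) = (((α / ‖vL‖ * D : ℝ)) : ℂ) := by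
    rw [hdotA, hDv]; push_cast; ring
  -- the value of the beat
  set gain : ℝ := Real.pi * (α / ‖vL‖ * D) * α * ‖ζ‖ with hgaindef
  have hinner : ⟪g, zB⟫_ℂ = (α : ℂ) * (-Complex.I * (‖ζ‖ : ℂ)) := by
    rw [hzBdef, inner_polB, ← hζdef]
    rw [show (-Complex.I * conj ζ * ((‖ζ‖⁻¹ : ℝ) : ℂ)) * (α : ℂ) * ζ =
        (α : ℂ) * ((-Complex.I * conj ζ * ((‖ζ‖⁻¹ : ℝ) : ℂ)) * ζ) by ring, phase_mul_self ζ hζ0]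
  have hbeat : Real.pi * (conj (((fun j => ((q) j : ℂ)) ⬝ᵥ (WithLp.ofLp (zA)))) * ⟪g, zB⟫_ℂ).im ≤ -gain := by
    rw [hqzA, hinner, Complex.conj_ofReal]
    have e : ((((α / ‖vL‖ * D : ℝ)) : ℂ) * ((α : ℂ) * (-Complex.I * (‖ζ‖ : ℂ)))).im =
        -(α / ‖vL‖ * D * α * ‖ζ‖) := by
      simp [Complex.mul_im, Complex.mul_re]
      ring
    rw [e, hgaindef]
    linarith
  -- the gain (slope-weighted)
  have hgain : 9 / 10 * α ^ 2 * (Real.sqrt (Torus.freqNormSq q) * ‖g‖) ≤ gain := by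
    have hT' : Torus.freqNormSq q * ‖g‖ ^ 2 ≤ 3 * ‖⟪g, EuclideanSpace.complexify (WithLp.toLp 2 a)⟫_ℂ‖ ^ 2 := hT
    have hDR : (D : ℝ) = (m : ℝ) ^ 2 * Torus.freqNormSq c := by rw [hDm]; push_cast; rw [hcc]
    have hpp4 : Torus.freqNormSq p ≤ 4 * (m : ℝ) ^ 2 := by
      have e4 : (((4 * N + 1 + 2 * K₀ : ℕ)) : ℝ) = 4 * N + 1 + 2 * K₀ := by push_cast; ring
      rw [e4] at hLp
      rw [hmR]
      nlinarith [(Nat.cast_nonneg N : (0:ℝ) ≤ N), (Nat.cast_nonneg K₀ : (0:ℝ) ≤ K₀)]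
    have hpp0 : 0 < Torus.freqNormSq p := by linarith
    have hm0 : 0 < (m : ℝ) := by linarith
    rw [hgaindef]
    have e : Real.pi * (α / ‖vL‖ * ↑D) * α * ‖ζ‖ = Real.pi * (α * ↑D / ‖vL‖) * α * ‖ζ‖ := by ring
    rw [e]
    exact axis_gain_bound_sqrt (r := α * D / ‖vL‖) rfl hvL2 hvLpos hDR hcc1 hpp4 hpp0 hζn hT'
      (Torus.freqNormSq_nonneg q) hα (norm_nonneg g) (norm_nonneg ζ) hm0
  exact ⟨p, zA, zB, gain, hNp, hNpq, hN5, hLp, hLpq, hsep, hdA, hdB, hBq, hzAn.le, hzBn.le, hbeat, hgain⟩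


end Summit.AnomalousDissipation.AnomalousDissipation.Theorems.KolmogorovFloor.Negative
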